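import Literature.MathematicalPhysics.QuantumFieldTheory.Balaban1983to89.B6RandomWalkL2
import Literature.MathematicalPhysics.QuantumFieldTheory.Balaban1983to89.B6Ineq2133TwoScaleV1
import Literature.MathematicalPhysics.QuantumFieldTheory.Balaban1983to89.B6Prop25Grad2DecayTwoScaleV1
import Literature.MathematicalPhysics.QuantumFieldTheory.Balaban1983to89.B6Prop25GradGDivDecayTwoScaleV1
import Literature.MathematicalPhysics.QuantumFieldTheory.Balaban1983to89.B6Prop25L2LocGradTwoScaleV1

/-!
# `Balaban1983to89.B6RandomWalkL2TwoScaleMembers` — T. Bałaban, *Propagators and renormalization transformations for lattice gauge theories. II*,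
# Commun. Math. Phys. **96** (1984) 223–250 [Balaban1984PropagatorsII], Prop. 2.5 p. 246 (*"G_□ … satisfies all the inequalities (1.110)–(1.114)"*) READ AS
# INPUTS OF THE `L²` WALK (2.141) p. 247: the `L²` members `G_□` ((1.114)₁), `∇_λG_□` ((1.114)₂), `∇_λ∇_μG_□` ((1.114)₅) and `∇_λG_□∇_μ*` ((1.114)₄) of the
# genuine two-scale `G_□` as BLOCK-`ℓ²` MAJORANTS on the member geometry `tsGeo` (file 6 of the block-`ℓ²` bricks of `…B6RandomWalkL2`)

statement-level skeleton of published theorems with citation tags; proofs where landed; nothing here is a claim about the Yang–Mills mass gap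

WHAT IS PRINTED (p. 246 [PDF 24], Prop. 2.5): *"The operator G_□ … satisfies all the inequalities (1.110)–(1.114) of the Proposition 1.2 with a positive
constant δ₂ instead of δ₀"*; [4] = [Balaban1984PropagatorsI], Prop. 1.2 (1.114) p. 36: *"‖ζGJ‖, ‖ζ∇GJ‖, ‖ζG∇*J‖, ‖ζ∇G∇*J‖, ‖ζ∇∇GJ‖, ‖ζG∇*∇*J‖ ≤
O(1)e^{−δ₀|y−y′|}|ζ|‖J‖ (1.114) for supp ζ ⊂ Δ̃(y), supp J ⊂ Δ̃(y′)"*; [B6] p. 247 [PDF 25] (2.141): *"the series above is convergent in the norms appearing in the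
inequalities (2.136)–(2.140)"*.

CITATION HEADER (lean-in-tree rule) — WHAT IS REPRODUCED.  Phase-2 file of the `lit-balaban` typed skeleton (HOME `run/shared/lean/pub/lit-balaban/`), seat
**p22 gen 29** (free-target protocol G.5-34(d), TAKING HOME/STATUS 2026-08-24T13:26Z, cc r03); SKELETON rows **B6.Prop2.5** × **B6.Prop2.6** × B6.Eq2.141 (cells
only; decls of record untouched).  p38 g23's `B6Ineq2133TwoScaleV1.ineq2133_G` reads p22's SUP member bounds of the genuine two-scale `G_□` (`TSIdx.D.G = (tsV1).G`)
as `HasMajorant (g := tsGeo i R M)` on the member's unit-lattice blocks `iterBlockOf j`; THIS FILE reads p22 gen 16's `ℓ²`-BLOCK member bounds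
(`B6Prop25Grad2DecayTwoScaleV1.l2blk_DDG_scaling`, `B6Prop25GradGDivDecayTwoScaleV1.l2blk_DGD_scaling`: `|⟨v, Tu⟩| ≤ C·e^{−δ₂|y−y′|_T}‖v‖‖u‖` for `v`, `u`
over the blocks of `y`, `y′`) and the printed `Σ`-shapes `B6Prop25L2LocTwoScaleV1.prop25_ineq114_0`, `B6Prop25L2LocGradTwoScaleV1.prop25_ineq114_grad`
(`Σ_b(ζ(b₋)(TJ)(b))² ≤ (C·e^{(1+2δ₂)r}·e^{−δ₂|y−y′|_T}·Z)²‖J‖²`, taken at the sharp cut-off `ζ = Δ(y)`, `r = 0`, `Z = 1`) as `…B6RandomWalkL2.HasL2Majorant (g := tsGeo i R M)` BY NAME: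
* §1 (generic) **`hasL2Majorant_onFun_of_inner_le`** — an inner-product block bound `|⟨v, fu⟩| ≤ K(y,y′)‖v‖‖u‖` for block-supported `v`, `u` IS the
  block-`ℓ²` majorant `K` of `onFun f` (take `v = Δ(y)·fu`); **`hasL2Majorant_onFun_of_sum_sq_le`** — the printed `Σ`-shape with site cut-offs `ζ` over `Δ(y)`,
  `|ζ| ≤ 1`, IS it too (take `ζ = Δ(y)`);
* §2 **`ineq2140_G_TS`** (`G_□`, (1.114)₁) and **`ineq2140_DG_TS`** (`∇_λG_□`, (1.114)₂) — the regular member legs, needed for the cut-off terms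
  `(∇∇h_□)G_□h_□`, `(∇h_□)(∇G_□)h_□` of the first leg `∇∇(h_□G_□h_□)` of (2.141) (the units `(Lʲη)²`, `Lʲη` of (1.114) are the `s(□)` of (2.94), absent in the
  tree's dimensionless member);
* §2 **`ineq2140_DDG_TS`** (`∇_λ∇_μG_□`, (1.114)₅) and **`ineq2140_DGD_TS`** (`∇_λG_□∇_μ*`, (1.114)₄): ONE `(δ₂, C)` on `d, L, a₀, a₁` for all members `i : TSIdx`,
  all directions: `HasL2Majorant (g := tsGeo i R M) (fun b => iterBlockOf i.j b.src) (onFun (i.Dl λ ∘ i.Dl μ ∘ i.D.G)) (C·e^{−δ₂·tdist})` and the same for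
  `onFun (i.Dl λ ∘ i.D.G ∘ i.Dla μ)` — the singular member legs of the `L²` walk for (2.140)₄,₅ (the sixth, `G_□∇*∇*`, is the transpose of the fifth:
  `…B6RandomWalkL2Schur.hasL2Majorant_transpose`).
THEOREMS ONLY (no definition, no `def … : Prop`, no new hypothesis); IMPORTS BY NAME, restating nothing; standard axioms.

HONEST SCOPE / DIVERGENCES.  (1) Member level only (two scales, the torus `T^{(j)}` of the member, weights `a₀(Lʲ)^{d+1} ≤ w ≤ a₁(Lʲ)^{d+1}`); the transport to
the cubes of the k-level V1 torus is `…B6RandomWalkL2Transplant` + r03's window charts (not done here).  (2) Unweighted `ℓ²` on the fine bonds; rate `δ₂` and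
constant `C` are p22 gen 16's (print: *"O(1)"*, *"δ₂ depending on d and L only"* — ours depend on `a₀, a₁` too, as every two-scale file of the cell).  (3) Toward
the unowned census slots (2.140)₄₋₆; NOT those slots.  NOT summit progress.  Unit `lit-balaban-p22` (gen 29), 2026-08-24.
-/

noncomputable section

open scoped BigOperators InnerProductSpace
open Finset

namespace Literature.MathematicalPhysics.QuantumFieldTheory.Balaban1983to89.B6RandomWalkL2TwoScaleMembers

open LatticeFieldCalculus
open B5Eq118OneStroke (iterBlockOf)
open B6RandomWalk (blockPiece)
open B6RandomWalkL2 (l2n l2n_nonneg l2n_sq HasL2Majorant)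
open B6SectAOperatorsV1 (inner_eq_sum)
open B6Ineq2133TwoScaleV1 (tsGeo onFun onFun_apply)
open B6Prop25TwoScaleCensus (TSIdx)
open B6Prop25Grad2DecayTwoScaleV1 (l2blk_DDG_scaling)
open B6Prop25GradGDivDecayTwoScaleV1 (l2blk_DGD_scaling)
open B6Prop25L2LocTwoScaleV1 (prop25_ineq114_0)
open B6Prop25L2LocGradTwoScaleV1 (prop25_ineq114_grad)
open B6Cov2110WeightV1 (torusSupNorm_zero)

/-! ## §1  An inner-product block bound is a block-`ℓ²` majorant -/

section Adapter

variable {g : B6.Geometry} {ι : Type} [Fintype ι]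

/-- **`|⟨v, fu⟩| ≤ K(y,y′)‖v‖‖u‖` FOR BLOCK-SUPPORTED `v`, `u` ⟹ `HasL2Majorant blk (onFun f) K`** (take `v = Δ(y)·fu`: `‖Δ(y)fu‖² = ⟨Δ(y)fu, fu⟩ ≤ K‖Δ(y)fu‖‖u‖`) —
the `ℓ²`-block shape of [Balaban1984PropagatorsI] (1.114) (p22 gen 16's `B6L2BlockCalculus` hypothesis shape) read as the block-`ℓ²` majorant of the `L²` walk
(2.141). [cite: Balaban1984PropagatorsII, (2.140)–(2.141) p.247; Balaban1984PropagatorsI, (1.114) p.36 (shape); derivation ours] -/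
theorem hasL2Majorant_onFun_of_inner_le (blk : ι → g.Site) (f : EuclideanSpace ℝ ι →ₗ[ℝ] EuclideanSpace ℝ ι) (K : g.Site → g.Site → ℝ)
    (hK : ∀ a b, 0 ≤ K a b)
    (h : ∀ (y y' : g.Site) (v u : EuclideanSpace ℝ ι), (∀ i, blk i ≠ y → v i = 0) → (∀ i, blk i ≠ y' → u i = 0) →
      |⟪v, f u⟫_ℝ| ≤ K y y' * (‖v‖ * ‖u‖)) :
    HasL2Majorant blk (onFun f) K := by
  intro y y' u hu
  set U : EuclideanSpace ℝ ι := WithLp.toLp 2 u with hU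
  set w : ι → ℝ := blockPiece blk y (onFun f u) with hw
  set V : EuclideanSpace ℝ ι := WithLp.toLp 2 w with hV
  have hVoff : ∀ i, blk i ≠ y → V i = 0 := fun i hi => by
    show w i = 0
    simp [hw, blockPiece, hi]
  have hUoff : ∀ i, blk i ≠ y' → U i = 0 := fun i hi => by
    show u i = 0
    exact hu i hi
  have hlw : l2n w = ‖V‖ := rfl
  have hlu : l2n u = ‖U‖ := rfl
  -- ‖V‖² = ⟨V, fU⟩
  have hsq : ‖V‖ ^ 2 = ⟪V, f U⟫_ℝ := by
    rw [← hlw, l2n_sq, inner_eq_sum]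
    refine Finset.sum_congr rfl fun i _ => ?_
    have hfU : f U i = onFun f u i := by rw [onFun_apply]
    show w i ^ 2 = w i * f U i
    rw [hfU]
    by_cases hi : blk i = y
    · simp [hw, blockPiece, hi, sq]
    · simp [hw, blockPiece, hi]
  have hbound : ‖V‖ ^ 2 ≤ K y y' * (‖V‖ * ‖U‖) := by
    rw [hsq]
    exact (le_abs_self _).trans (h y y' V U hVoff hUoff)
  rw [hlw, hlu]
  by_cases h0 : ‖V‖ = 0
  · rw [h0]; exact mul_nonneg (hK _ _) (norm_nonneg _)
  · have hpos : 0 < ‖V‖ := lt_of_le_of_ne (norm_nonneg _) (Ne.symm h0)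
    have : ‖V‖ * ‖V‖ ≤ (K y y' * ‖U‖) * ‖V‖ := by nlinarith [hbound]
    exact le_of_mul_le_mul_right this hpos

/-- **THE PRINTED `Σ`-SHAPE OF (1.114) ⟹ `HasL2Majorant`** for bond operators read through a SITE block map `blkS` (bonds sit in the block of their
source): if for all blocks `y, y′`, every site cut-off `ζ` supported over `Δ(y)` with `|ζ| ≤ 1` and every `J` supported over `Δ(y′)`
`Σ_b (ζ(b₋)·(fJ)(b))² ≤ K(y,y′)²‖J‖²`, then `onFun f` has the block-`ℓ²` majorant `K` (`K ≥ 0`; take `ζ = Δ(y)`).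
[cite: Balaban1984PropagatorsII, (2.140)–(2.141) p.247; Balaban1984PropagatorsI, (1.114) p.36 (shape); derivation ours] -/
theorem hasL2Majorant_onFun_of_sum_sq_le {P : Params} (blkS : Site P 0 → g.Site) (f : EuclideanSpace ℝ (PBond P 0) →ₗ[ℝ] EuclideanSpace ℝ (PBond P 0))
    (K : g.Site → g.Site → ℝ) (hK : ∀ a b, 0 ≤ K a b)
    (h : ∀ (y y' : g.Site) (ζ : Site P 0 → ℝ) (J : EuclideanSpace ℝ (PBond P 0)), (∀ x, blkS x ≠ y → ζ x = 0) → (∀ x, |ζ x| ≤ 1) →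
      (∀ b, blkS b.src ≠ y' → J b = 0) → ∑ b, (ζ b.src * f J b) ^ 2 ≤ (K y y') ^ 2 * ‖J‖ ^ 2) :
    HasL2Majorant (fun b : PBond P 0 => blkS b.src) (onFun f) K := by
  classical
  intro y y' u hu
  set U : EuclideanSpace ℝ (PBond P 0) := WithLp.toLp 2 u with hU
  have hlu : l2n u = ‖U‖ := rfl
  set ζ : Site P 0 → ℝ := fun x => if blkS x = y then 1 else 0 with hζ
  have hζ0 : ∀ x, blkS x ≠ y → ζ x = 0 := fun x hx => by simp [hζ, hx]
  have hζ1 : ∀ x, |ζ x| ≤ 1 := fun x => by by_cases hx : blkS x = y <;> simp [hζ, hx]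
  have hsq : l2n (blockPiece (fun b : PBond P 0 => blkS b.src) y (onFun f u)) ^ 2 = ∑ b, (ζ b.src * f U b) ^ 2 := by
    rw [l2n_sq]
    refine Finset.sum_congr rfl fun b _ => ?_
    by_cases hb : blkS b.src = y <;> simp [blockPiece, hζ, hb, onFun_apply, hU]
  have h2 : l2n (blockPiece (fun b : PBond P 0 => blkS b.src) y (onFun f u)) ^ 2 ≤ (K y y' * l2n u) ^ 2 := by
    rw [hsq, mul_pow, hlu]
    exact h y y' ζ U hζ0 hζ1 (fun b hb => hu b hb)
  have := Real.sqrt_le_sqrt h2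
  rwa [Real.sqrt_sq (l2n_nonneg _), Real.sqrt_sq (mul_nonneg (hK y y') (l2n_nonneg u))] at this

end Adapter

/-! ## §2  The two-derivative `L²` members of the genuine two-scale `G_□` as block-`ℓ²` majorants on `tsGeo` -/

section Members

variable {d L : ℕ} {hd : 1 ≤ d + 1} {hL : Odd L ∧ 1 < L} {a₀ a₁ : ℝ}

/-- **(1.114)₅ FOR THE GENUINE TWO-SCALE `G_□` AS A BLOCK-`ℓ²` MAJORANT** (*"‖ζ∇∇GJ‖ ≤ O(1)e^{−δ₀|y−y′|}|ζ|‖J‖"*, Prop. 2.5: *"with δ₂ instead of δ₀"*): ONE `(δ₂, C)` on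
`d, L, a₀, a₁` such that for every member `i` and directions `λ, μ`: `HasL2Majorant (tsGeo i) (iterBlockOf j ∘ src) (onFun (∇_λ∇_μG_□)) (C·e^{−δ₂|y−y′|_T})` —
p22 gen 16's `l2blk_DDG_scaling` BY NAME through §1. [cite: Balaban1984PropagatorsII, Prop. 2.5 p.246, (2.141) p.247; Balaban1984PropagatorsI, Prop. 1.2 (1.114) p.36] -/
theorem ineq2140_DDG_TS (d L : ℕ) (hd : 1 ≤ d + 1) (hL : Odd L ∧ 1 < L) {a₀ a₁ : ℝ} (ha₀ : 0 < a₀) (ha₁ : a₀ ≤ a₁) :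
    ∃ δ : ℝ, 0 < δ ∧ ∃ C : ℝ, 0 ≤ C ∧ ∀ (i : TSIdx d L hd hL a₀ a₁) (R M : ℝ) (lam mu : Fin (d + 1)),
      HasL2Majorant (g := tsGeo i R M) (fun b : PBond i.P 0 => iterBlockOf i.j b.src) (onFun (i.Dl lam ∘ₗ i.Dl mu ∘ₗ i.D.G))
        (fun y y' => C * Real.exp (-(δ * i.tdist y y'))) := by
  obtain ⟨δ, hδ, C, hC, h⟩ := l2blk_DDG_scaling d L hd hL ha₀ ha₁
  refine ⟨δ, hδ, C, hC, fun i R M lam mu => ?_⟩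
  refine hasL2Majorant_onFun_of_inner_le (g := tsGeo i R M) (fun b : PBond i.P 0 => iterBlockOf i.j b.src) _ _
    (fun a b => mul_nonneg hC (Real.exp_nonneg _)) fun y y' v u hv hu => ?_
  exact h i.m i.K i.j i.hc i.hj i.Λ' i.w i.hw0 i.hw1 lam mu y y' v u hv hu

/-- **(1.114)₄ FOR THE GENUINE TWO-SCALE `G_□` AS A BLOCK-`ℓ²` MAJORANT** (*"‖ζ∇G∇*J‖"*): the same for `onFun (∇_λG_□∇_μ*)` — p22 gen 16's `l2blk_DGD_scaling` BY NAME.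
[cite: Balaban1984PropagatorsII, Prop. 2.5 p.246, (2.141) p.247; Balaban1984PropagatorsI, Prop. 1.2 (1.114) p.36] -/
theorem ineq2140_DGD_TS (d L : ℕ) (hd : 1 ≤ d + 1) (hL : Odd L ∧ 1 < L) {a₀ a₁ : ℝ} (ha₀ : 0 < a₀) (ha₁ : a₀ ≤ a₁) :
    ∃ δ : ℝ, 0 < δ ∧ ∃ C : ℝ, 0 ≤ C ∧ ∀ (i : TSIdx d L hd hL a₀ a₁) (R M : ℝ) (lam mu : Fin (d + 1)),
      HasL2Majorant (g := tsGeo i R M) (fun b : PBond i.P 0 => iterBlockOf i.j b.src) (onFun (i.Dl lam ∘ₗ i.D.G ∘ₗ i.Dla mu))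
        (fun y y' => C * Real.exp (-(δ * i.tdist y y'))) := by
  obtain ⟨δ, hδ, C, hC, h⟩ := l2blk_DGD_scaling d L hd hL ha₀ ha₁
  refine ⟨δ, hδ, C, hC, fun i R M lam mu => ?_⟩
  refine hasL2Majorant_onFun_of_inner_le (g := tsGeo i R M) (fun b : PBond i.P 0 => iterBlockOf i.j b.src) _ _
    (fun a b => mul_nonneg hC (Real.exp_nonneg _)) fun y y' v u hv hu => ?_
  exact h i.m i.K i.j i.hc i.hj i.Λ' i.w i.hw0 i.hw1 lam mu y y' v u hv hu

/-- **(1.114)₁ FOR THE GENUINE TWO-SCALE `G_□` AS A BLOCK-`ℓ²` MAJORANT** (*"‖ζGJ‖ ≤ O(1)(Lʲη)²e^{−δ₀|y−y′|}|ζ|‖J‖"*; the `(Lʲη)²` is the unit `s(□)`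
of (2.94), absent in the tree's dimensionless member): `HasL2Majorant (tsGeo i) (iterBlockOf j ∘ src) (onFun G_□) (C·e^{−δ₂|y−y′|_T})` — p22 gen 16's
`prop25_ineq114_0` BY NAME at the sharp cut-off (`ζ = Δ(y)`, `r = 0`, `Z = 1`) through §1.
[cite: Balaban1984PropagatorsII, Prop. 2.5 p.246, (2.94) p.239, (2.141) p.247; Balaban1984PropagatorsI, Prop. 1.2 (1.114) p.36] -/
theorem ineq2140_G_TS (d L : ℕ) (hd : 1 ≤ d + 1) (hL : Odd L ∧ 1 < L) {a₀ a₁ : ℝ} (ha₀ : 0 < a₀) (ha₁ : a₀ ≤ a₁) :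
    ∃ δ : ℝ, 0 < δ ∧ ∃ C : ℝ, 0 ≤ C ∧ ∀ (i : TSIdx d L hd hL a₀ a₁) (R M : ℝ),
      HasL2Majorant (g := tsGeo i R M) (fun b : PBond i.P 0 => iterBlockOf i.j b.src) (onFun i.D.G)
        (fun y y' => C * Real.exp (-(δ * i.tdist y y'))) := by
  classical
  obtain ⟨δ, hδ, C, hC, h⟩ := prop25_ineq114_0 d L hd hL ha₀ ha₁
  refine ⟨δ, hδ, C, hC, fun i R M => ?_⟩
  refine hasL2Majorant_onFun_of_sum_sq_le (g := tsGeo i R M) (iterBlockOf i.j) _ _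
    (fun a b => mul_nonneg hC (Real.exp_nonneg _)) fun y y' ζ J hζ0 hζ1 hJ => ?_
  have h1 := h i.m i.K i.j i.hc i.hj i.Λ' i.w i.hw0 i.hw1 0 le_rfl J ζ 1 zero_le_one y y'
    (fun b hb => by
      have hby : iterBlockOf i.j b.src = y' := by by_contra hne; exact hb (hJ b hne)
      rw [hby, sub_self, torusSupNorm_zero])
    (fun x hx => by
      have hxy : iterBlockOf i.j x = y := by by_contra hne; exact hx (hζ0 x hne)
      rw [hxy, sub_self, torusSupNorm_zero])
    hζ1
  refine h1.trans (le_of_eq ?_)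
  rw [mul_zero, Real.exp_zero, mul_one, mul_one]
  rfl

/-- **(1.114)₂ FOR THE GENUINE TWO-SCALE `G_□` AS A BLOCK-`ℓ²` MAJORANT** (*"‖ζ∇GJ‖ ≤ O(1)Lʲη·e^{−δ₀|y−y′|}|ζ|‖J‖"*, the `Lʲη` again the unit): for every
direction `λ`, `HasL2Majorant (tsGeo i) (iterBlockOf j ∘ src) (onFun (∇_λG_□)) (C·e^{−δ₂|y−y′|_T})` — p22 gen 16's `prop25_ineq114_grad` BY NAME at the
sharp cut-off through §1 (`i.Dl λ = Lʲ·(S_λ − 1)`, `TSIdx.Dl_apply`). [cite: Balaban1984PropagatorsII, Prop. 2.5 p.246, (2.94) p.239, (2.141) p.247; Balaban1984PropagatorsI, Prop. 1.2 (1.114) p.36] -/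
theorem ineq2140_DG_TS (d L : ℕ) (hd : 1 ≤ d + 1) (hL : Odd L ∧ 1 < L) {a₀ a₁ : ℝ} (ha₀ : 0 < a₀) (ha₁ : a₀ ≤ a₁) :
    ∃ δ : ℝ, 0 < δ ∧ ∃ C : ℝ, 0 ≤ C ∧ ∀ (i : TSIdx d L hd hL a₀ a₁) (R M : ℝ) (lam : Fin (d + 1)),
      HasL2Majorant (g := tsGeo i R M) (fun b : PBond i.P 0 => iterBlockOf i.j b.src) (onFun (i.Dl lam ∘ₗ i.D.G))
        (fun y y' => C * Real.exp (-(δ * i.tdist y y'))) := by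
  classical
  obtain ⟨δ, hδ, C, hC, h⟩ := prop25_ineq114_grad d L hd hL ha₀ ha₁
  refine ⟨δ, hδ, C, hC, fun i R M lam => ?_⟩
  refine hasL2Majorant_onFun_of_sum_sq_le (g := tsGeo i R M) (iterBlockOf i.j) _ _
    (fun a b => mul_nonneg hC (Real.exp_nonneg _)) fun y y' ζ J hζ0 hζ1 hJ => ?_
  have h1 := h i.m i.K i.j i.hc i.hj i.Λ' i.w i.hw0 i.hw1 lam 0 le_rfl J ζ 1 zero_le_one y y'
    (fun b hb => by
      have hby : iterBlockOf i.j b.src = y' := by by_contra hne; exact hb (hJ b hne)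
      rw [hby, sub_self, torusSupNorm_zero])
    (fun x hx => by
      have hxy : iterBlockOf i.j x = y := by by_contra hne; exact hx (hζ0 x hne)
      rw [hxy, sub_self, torusSupNorm_zero])
    hζ1
  have hop : ∀ b₀ : PBond i.P 0, (i.Dl lam ∘ₗ i.D.G) J b₀ = ((L : ℝ) ^ i.j) * (i.D.G J ⟨b₀.src.shift lam, b₀.dir⟩ - i.D.G J b₀) := fun b₀ => by
    rw [LinearMap.comp_apply, TSIdx.Dl_apply]
  simp only [hop]
  refine h1.trans (le_of_eq ?_)
  rw [mul_zero, Real.exp_zero, mul_one, mul_one]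
  rfl

end Members

end Literature.MathematicalPhysics.QuantumFieldTheory.Balaban1983to89.B6RandomWalkL2TwoScaleMembers
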